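import Summits.QuantumFields.YangMills.Theorems.MirrorModularBoostsHypercubicLimitPeelReflSlice
import Summits.QuantumFields.YangMills.Theorems.MirrorModularBoostsHypercubicLimitPeelRpFamDefs
import Summits.QuantumFields.YangMills.Theorems.PencilRigidityHypercubicLimitScaledPlaneLimits
import Literature.MathematicalPhysics.QuantumFieldTheory.SchwingerLimitInheritance
import HarnessLib

/-!
# Crux `HypercubicLimit` (stmt-QuantumFields-16154), line `peel-and-disseminate`: (R1) hermiticity and reflection positivity of the one-field limits

Support file (c3 seat) proving the registered piece (R1) `stub_reflHermRP` of the host closure's reflection leg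
(R) `ReflectionLegsP` (crux stmt-QuantumFields-8646, line `conditional-mean-telescoping`, vocabulary
`PencilRigidityHypercubicLimitDefs(B).lean`): for every `(G, r)` with `GapData` there is a torus demand `Λ`
(`rhDemand m`: `L ≥ max (1, m(β)⁻²)`, i.e. `L_k ≥ a_k⁻²` in units `a = m(β)`) such that for every `SoftData`
witness obeying it and `PolyRenorm`, the one-field limit `S₁` is OS-hermitian and reflection positive.

Route (the 8646-c1 seat's plan, `Cruxes/HypercubicLimit/CONSULT-c1-softdata.md`; all inputs landed):
* the RP-ADAPTED lattice family `rpFam` of the scheme (`MirrorModularBoostsHypercubicLimitPeelRpFamDefs.lean`: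
  plaquette `(q, x)` at its RP corner `a (x + (e_i + e_j − e₀)/2)`, temporal corners over the box, spatial ones
  over its time slab `[1−L, L]`, weights `λⁿ W^{q}(x)`, `λ = c_k a_k⁴`) is EXACTLY hermitian (`rpBlock_hermitian`)
  and EXACTLY reflection positive for `β ≥ 0`, `L ≥ 1`, `a > 0` (`rpBlock_reflectionPositive`);
* §1 it has the SAME LIMIT on `⁰𝒮` as `SoftData`'s renormalised plane-string distributions
  (`tendsto_rpTerm`, `tendsto_rpFam`): per orientation string the two differ by (i) the constant shifts `c_q`,
  `‖c_q‖ ≤ 2a` — mean value theorem at intermediate points within `2a ≤ 6a` of `a x`, closed by `SoftData`'s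
  shifted uniform bound — and (ii) the boundary time slice `x₀ = −L` of the spatial corners, at physical distance
  `≥ a L ≥ a⁻¹`, which is `O(a^{E+1})` by Schwartz decay of order `10n+1+E`; with `E = Q n` the renormalisation
  `λ_k ≤ a_k^{-Q}` (`PolyRenorm`) is absorbed (`rh_sameLimit` of
  `MirrorModularBoostsHypercubicLimitPeelReflSlice.lean`), so the difference is `O(a_k) → 0` (`a_k = m(β_k) → 0`:
  `GapData` (i)–(ii), `β_k → ∞`); `n = 0, 1` by `S₁ 0 = δ`, `S₁ 1 = 0` and exact centring; the plane expansion
  `S₁ n = Σ_q Spl n q` (`n ≥ 2`) is reindexed over `{q // q.1 < q.2}ⁿ`;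
* §2 both properties pass to pointwise limits on `⁰𝒮` (`isHermitian_of_tendsto`,
  `isReflectionPositive_of_tendsto` of `Literature/…/SchwingerLimitInheritance`).

`reflHermRP_of_torusBound` is the same statement with the demand explicit (`1 ≤ L_k`, `a_k⁻² ≤ L_k`, any `Λ`).
The demand is NECESSARY for this route: the RP-adapted and canonical families differ by the boundary slice at
physical time `−a_k L_k`, invisible to a fixed test function only if `a_k L_k → ∞` fast enough against `λ_kⁿ`.

Refs: OsterwalderSchrader1973 §§3–4 (E0, E2); OsterwalderSchrader1975 §§2, 4 (`⁰𝒮`, E0′); OsterwalderSeiler1978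
§§2–3 (lattice RP); GlimmJaffe1987 §6.1; `PencilRigidityHypercubicLimitDefs.lean` §7.
-/

set_option autoImplicit false
noncomputable section
open scoped SchwartzMap ENNReal
open MeasureTheory Filter Topology
open Literature.MathematicalPhysics.AQFT Literature.MathematicalPhysics.QuantumLattice
open Literature.MathematicalPhysics.QuantumFieldTheory
open Literature.Probability.LatticeModels (box Site)
open Summit.QuantumFields.YangMills.Cruxes.HypercubicLimit.ConditionalMeanTelescoping
open Summit.QuantumFields.YangMills.Theorems.HypercubicLimit.Negative (torusPlaquette)
open Summit.QuantumFields.YangMills.Theorems.OSLegsFromFemtoAndGap (torusMomentStr latticeDistStr latticeDist)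

namespace Summit.QuantumFields.YangMills.Cruxes.HypercubicLimit.PeelAndDisseminate

/-! ## §1 Convergence of the RP-adapted family of the scheme on `⁰𝒮` -/

section Convergence

variable {G : Type} [Group G] [TopologicalSpace G] [IsTopologicalGroup G] [CompactSpace G]
  [MeasurableSpace G] [BorelSpace G]

/-- **Per-orientation convergence.**  Along a scheme with `a_k → 0`, eventually `0 < a_k`, `a_k⁻² ≤ L_k`,
renormalisation `0 ≤ c_k ≤ a_k^{-Q}` and the shifted uniform bound for the orientation string `q`, the
renormalised RP-adapted plane-string distribution has the same limit on `⁰𝒮` as the renormalised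
canonical one (`rh_sameLimit`: the difference is `O(a_k)`). -/
theorem tendsto_rpTerm (r : LatticeRep G) (sch : SpeciesScheme (YMSpecies G)) {n : ℕ}
    (q : Fin n → {q : Fin 4 × Fin 4 // q.1 < q.2}) (F : 𝓢((Fin n → EuclideanSpace ℝ (Fin 4)), ℂ))
    (hF : IsOffDiagonal F) {K : ℝ} {γ s Q : ℕ} (hK : 0 ≤ K)
    (ha0 : Tendsto sch.a atTop (𝓝 0)) (hapos : ∀ᶠ k in atTop, 0 < sch.a k)
    (hL : ∀ᶠ k in atTop, (sch.a k)⁻¹ * (sch.a k)⁻¹ ≤ (sch.L k : ℝ))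
    (hc0 : ∀ k, 0 ≤ sch.c r.curvature k) (hcQ : ∀ k, sch.c r.curvature k ≤ ((sch.a k)⁻¹) ^ Q)
    (hU : ∀ᶠ k in atTop, ∀ (y : (Fin n → Site 4) → (Fin n → EuclideanSpace ℝ (Fin 4))),
      (∀ x l, ‖y x l - sch.a k • siteToE (x l)‖ ≤ 6 * sch.a k) →
        ∀ G : 𝓢((Fin n → EuclideanSpace ℝ (Fin 4)), ℂ), IsOffDiagonal G →
          (sch.c r.curvature k * sch.a k ^ 4) ^ n *
              ‖∑ x ∈ Fintype.piFinset (fun _ : Fin n => box 4 (sch.L k)),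
                  ((planeWeight r (sch.β k) (sch.L k) (fun i => (q i).1) x : ℝ) : ℂ) * G (y x)‖ ≤
            (K * (n : ℝ) ^ γ) ^ n * schwartzNorm (s * n) G)
    {ℓ : ℂ} (hlim : Tendsto (fun k => (((sch.c r.curvature k * sch.a k ^ 4) ^ n : ℝ) : ℂ) *
      latticeDistStr r.ρ (sch.β k) (sch.L k) (sch.a k) (fun i => planeObs r (q i).1)
        (fun i => wilsonTorusMean r.ρ (sch.β k) (sch.L k) (planeObs r (q i).1)) F) atTop (𝓝 ℓ)) :
    Tendsto (fun k => (((sch.c r.curvature k * sch.a k ^ 4) ^ n : ℝ) : ℂ) *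
      ∑ x ∈ Fintype.piFinset (fun j => rpDom (sch.L k) (q j)),
        ((planeWeight r (sch.β k) (sch.L k) (fun i => (q i).1) x : ℝ) : ℂ) *
          F (fun l => sch.a k • siteToE (x l) + rpShift (sch.a k) (q l))) atTop (𝓝 ℓ) := by
  set lam : ℕ → ℝ := fun k => sch.c r.curvature k * sch.a k ^ 4 with hlam
  set main : ℕ → ℂ := fun k => ((lam k ^ n : ℝ) : ℂ) *
    ∑ x ∈ Fintype.piFinset (fun _ : Fin n => box 4 (sch.L k)),
      ((planeWeight r (sch.β k) (sch.L k) (fun i => (q i).1) x : ℝ) : ℂ) *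
        F (fun l => sch.a k • siteToE (x l)) with hmain_def
  set term : ℕ → ℂ := fun k => ((lam k ^ n : ℝ) : ℂ) *
    ∑ x ∈ Fintype.piFinset (fun j => rpDom (sch.L k) (q j)),
      ((planeWeight r (sch.β k) (sch.L k) (fun i => (q i).1) x : ℝ) : ℂ) *
        F (fun l => sch.a k • siteToE (x l) + rpShift (sch.a k) (q l)) with hterm_def
  have hmain : Tendsto main atTop (𝓝 ℓ) :=
    hlim.congr fun k => by rw [latticeDistStr_planeObs_apply]
  have hlam0 : ∀ k, 0 ≤ lam k := fun k => mul_nonneg (hc0 k) (by positivity)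
  -- the constant of the `O(a_k)` bound
  set Z : ℝ := 81 * ∑' j : ℕ, (((j : ℝ) + 1) ^ 2)⁻¹ with hZ
  set C : ℝ := 4 * (K * (n : ℝ) ^ γ) ^ n * schwartzNorm (s * n + 1) F +
    (2 * (r.N : ℝ)) ^ n * 2 ^ (16 * n + 2) * Z ^ n * 4 ^ (10 * n + 1 + Q * n) *
      schwartzNorm (10 * n + 1 + Q * n) F with hC
  have ha2 : ∀ᶠ k in atTop, sch.a k ≤ 1 / 2 := ha0.eventually_le_const (by norm_num)
  have hbound : ∀ᶠ k in atTop, ‖term k - main k‖ ≤ sch.a k * C := by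
    filter_upwards [hapos, ha2, hL, hU] with k hk1 hk2 hk3 hk4
    have ha1 : sch.a k ≤ 1 := hk2.trans (by norm_num)
    rw [hterm_def, hmain_def]
    dsimp only
    rw [← mul_sub, norm_mul, Complex.norm_real, Real.norm_of_nonneg (pow_nonneg (hlam0 k) n)]
    refine rh_sameLimit n (sch.L k) (s * n) (Q * n) (2 * r.N) (sch.a k) (lam k) ((K * (n : ℝ) ^ γ) ^ n)
      (planeWeight r (sch.β k) (sch.L k) (fun i => (q i).1))
      (Fintype.piFinset (fun j => rpDom (sch.L k) (q j))) (fun l => rpShift (sch.a k) (q l)) F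
      (by positivity) (abs_planeWeight_le_pow r _ _ _) hk1 hk2 hk3 (by positivity) (hlam0 k) ?_
      (rpDom_subset _ q) (fun x hx hxD => rpDom_far _ q x hx hxD) (fun l => norm_rpShift_le hk1.le (q l))
      hF ?_
    · -- `λⁿ a^{Qn} ≤ 1`
      have h1 : lam k ≤ ((sch.a k)⁻¹) ^ Q :=
        calc lam k = sch.c r.curvature k * sch.a k ^ 4 := rfl
          _ ≤ sch.c r.curvature k * 1 :=
              mul_le_mul_of_nonneg_left (pow_le_one₀ hk1.le ha1) (hc0 k)
          _ ≤ ((sch.a k)⁻¹) ^ Q := by rw [mul_one]; exact hcQ k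
      calc lam k ^ n * sch.a k ^ (Q * n) ≤ (((sch.a k)⁻¹) ^ Q) ^ n * sch.a k ^ (Q * n) :=
            mul_le_mul_of_nonneg_right (pow_le_pow_left₀ (hlam0 k) h1 n) (pow_nonneg hk1.le _)
        _ = 1 := by
            rw [← pow_mul, ← mul_pow, inv_mul_cancel₀ hk1.ne', one_pow]
    · intro y hy G' hG'
      exact hk4 y (fun x l => (hy x l).trans (by linarith)) G' hG'
  have hdiff : Tendsto (fun k => term k - main k) atTop (𝓝 0) :=
    squeeze_zero_norm' hbound (by simpa using ha0.mul_const C)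
  have h := hdiff.add hmain
  rw [zero_add] at h
  exact h.congr fun k => sub_add_cancel _ _

/-- **The RP-adapted family of a `SoftData`-type scheme converges to the one-field limit on `⁰𝒮`.**
Hypotheses: units `a_k → 0`, eventually `0 < a_k` and `a_k⁻² ≤ L_k`, renormalisation `0 ≤ c_k ≤ a_k^{-Q}`,
the convergence of the renormalised plane-string distributions to `Spl`, the plane expansion of `S₁ n`
(`n ≥ 2`), `S₁ 0 = δ`, `S₁ 1 = 0`, and the shifted uniform bound (eventually, per `n ≥ 2`). -/
theorem tendsto_rpFam (r : LatticeRep G) (sch : SpeciesScheme (YMSpecies G))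
    (S₁ : SchwingerFamily (EuclideanSpace ℝ (Fin 4)))
    (Spl : (n : ℕ) → (Fin n → Fin 4 × Fin 4) → (𝓢((Fin n → EuclideanSpace ℝ (Fin 4)), ℂ) →L[ℂ] ℂ))
    {K : ℝ} {γ s Q : ℕ} (hK : 0 ≤ K)
    (ha0 : Tendsto sch.a atTop (𝓝 0)) (hapos : ∀ᶠ k in atTop, 0 < sch.a k)
    (hL : ∀ᶠ k in atTop, (sch.a k)⁻¹ * (sch.a k)⁻¹ ≤ (sch.L k : ℝ))
    (hc0 : ∀ k, 0 ≤ sch.c r.curvature k) (hcQ : ∀ k, sch.c r.curvature k ≤ ((sch.a k)⁻¹) ^ Q)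
    (hSpl : ∀ (n : ℕ) (q : Fin n → Fin 4 × Fin 4), (∀ i, (q i).1 ≠ (q i).2) →
      ∀ F : 𝓢((Fin n → EuclideanSpace ℝ (Fin 4)), ℂ), IsOffDiagonal F →
        Tendsto (fun k => (((sch.c r.curvature k * sch.a k ^ 4) ^ n : ℝ) : ℂ) *
          latticeDistStr r.ρ (sch.β k) (sch.L k) (sch.a k) (fun i => planeObs r (q i))
            (fun i => wilsonTorusMean r.ρ (sch.β k) (sch.L k) (planeObs r (q i))) F) atTop
              (𝓝 (Spl n q F)))
    (hexp : ∀ n : ℕ, 2 ≤ n → ∀ F : 𝓢((Fin n → EuclideanSpace ℝ (Fin 4)), ℂ), IsOffDiagonal F →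
      S₁ n F = ∑ q ∈ Fintype.piFinset
        (fun _ : Fin n => Finset.univ.filter fun p : Fin 4 × Fin 4 => p.1 < p.2), Spl n q F)
    (hS0 : ∀ F : 𝓢((Fin 0 → EuclideanSpace ℝ (Fin 4)), ℂ), S₁ 0 F = F default)
    (hS1 : ∀ F : 𝓢((Fin 1 → EuclideanSpace ℝ (Fin 4)), ℂ), S₁ 1 F = 0)
    (hU : ∀ n : ℕ, 2 ≤ n → ∀ᶠ k in atTop, ∀ (q : Fin n → Fin 4 × Fin 4), (∀ i, (q i).1 ≠ (q i).2) →
      ∀ (y : (Fin n → Site 4) → (Fin n → EuclideanSpace ℝ (Fin 4))),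
        (∀ x l, ‖y x l - sch.a k • siteToE (x l)‖ ≤ 6 * sch.a k) →
          ∀ F : 𝓢((Fin n → EuclideanSpace ℝ (Fin 4)), ℂ), IsOffDiagonal F →
            (sch.c r.curvature k * sch.a k ^ 4) ^ n *
                ‖∑ x ∈ Fintype.piFinset (fun _ : Fin n => box 4 (sch.L k)),
                    ((planeWeight r (sch.β k) (sch.L k) q x : ℝ) : ℂ) * F (y x)‖ ≤
              (K * (n : ℝ) ^ γ) ^ n * schwartzNorm (s * n) F)
    (n : ℕ) (F : 𝓢((Fin n → EuclideanSpace ℝ (Fin 4)), ℂ)) (hF : IsOffDiagonal F) :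
    Tendsto (fun k => rpFam r (sch.β k) (sch.L k) (sch.a k) (sch.c r.curvature k * sch.a k ^ 4) n F)
      atTop (𝓝 (S₁ n F)) := by
  match n, F, hF with
  | 0, F, _ =>
    simp only [rpFam_zero, hS0 F]
    exact tendsto_const_nhds
  | 1, F, _ =>
    simp only [rpFam_one, hS1 F]
    exact tendsto_const_nhds
  | (n + 2), F, hF =>
    rw [hexp (n + 2) (by omega) F hF, sum_piFinset_filter_eq]
    simp only [rpFam_apply]
    refine tendsto_finsetSum _ fun q _ => ?_
    have hq : ∀ i, ((fun i => (q i).1) i).1 ≠ ((fun i => (q i).1) i).2 := fun i => ne_of_lt (q i).2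
    exact tendsto_rpTerm r sch q F hF hK ha0 hapos hL hc0 hcQ
      ((hU (n + 2) (by omega)).mono fun k hk => hk (fun i => (q i).1) hq)
      (hSpl (n + 2) (fun i => (q i).1) hq F hF)

end Convergence

/-! ## §2 Hermiticity and reflection positivity of the one-field limits -/

section Assembly

variable {G : Type} [Group G] [TopologicalSpace G] [IsTopologicalGroup G] [CompactSpace G]
  [MeasurableSpace G] [BorelSpace G]

/-- **(R1) with an explicit torus lower bound.**  For every `SoftData` witness with `PolyRenorm` whose tori
obey `1 ≤ L_k` and `a_k⁻² ≤ L_k`, the one-field limit `S₁` is OS-hermitian and reflection positive: the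
RP-adapted lattice family of the scheme is exactly hermitian (`rpBlock_hermitian`) and, eventually, exactly
reflection positive (`rpBlock_reflectionPositive`; `β_k ≥ 0`, `a_k = m(β_k) > 0` eventually by `GapData` (i)
and `β_k → ∞`), it converges to `S₁` on `⁰𝒮` (`tendsto_rpFam`; `a_k → 0` by `GapData` (ii)), and both
properties pass to pointwise limits on `⁰𝒮` (`isHermitian_of_tendsto`, `isReflectionPositive_of_tendsto`). -/
theorem reflHermRP_of_torusBound (r : LatticeRep G) {β₁ C₁ c₂ : ℝ} {m : ℝ → ℝ}
    (hgap : GapData G r β₁ C₁ c₂ m) {Λ : ℝ → ℕ → ℕ} {δ₀ : ℝ} {sch : SpeciesScheme (YMSpecies G)}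
    {S₁ : SchwingerFamily (EuclideanSpace ℝ (Fin 4))}
    {Spl : (n : ℕ) → (Fin n → Fin 4 × Fin 4) → (𝓢((Fin n → EuclideanSpace ℝ (Fin 4)), ℂ) →L[ℂ] ℂ)}
    (hD : SoftData r m δ₀ Λ sch S₁ Spl) (hP : PolyRenorm r sch) (hL1 : ∀ k, 1 ≤ sch.L k)
    (hL2 : ∀ k, (sch.a k)⁻¹ * (sch.a k)⁻¹ ≤ (sch.L k : ℝ)) :
    S₁.toLabelled.IsHermitian ∧ S₁.toLabelled.IsReflectionPositive := by
  obtain ⟨hunits, hβ, -, -, hc, -, hSpl, -, hexp, hS0, hS1, ⟨K, γ, s, hK, hUB, -, -⟩, -, -⟩ := hD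
  obtain ⟨Q, hQ⟩ := hP
  have ha0 : Tendsto sch.a atTop (𝓝 0) := (hgap.2.1.comp hβ).congr fun k => (hunits k).symm
  have hapos : ∀ᶠ k in atTop, 0 < sch.a k :=
    (hβ.eventually_ge_atTop β₁).mono fun k hk => by rw [hunits k]; exact hgap.1 _ hk
  have hβ0 : ∀ᶠ k in atTop, 0 ≤ sch.β k := hβ.eventually_ge_atTop 0
  have hc0 : ∀ k, 0 ≤ sch.c r.curvature k := fun k => by
    rw [hc k]; exact inv_nonneg.2 (Real.sqrt_nonneg _)
  have hconv := tendsto_rpFam r sch S₁ Spl hK ha0 hapos (Eventually.of_forall hL2) hc0 hQ hSpl hexp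
    hS0 hS1 hUB
  refine ⟨isHermitian_of_tendsto hconv (Eventually.of_forall fun k => rpFam_isHermitian r _ _ _ _),
    isReflectionPositive_of_tendsto hconv ?_⟩
  exact (hapos.and hβ0).mono fun k hk => rpFam_isReflectionPositive r _ hk.2 (hL1 k) hk.1

end Assembly

/-- **(R1) Hermiticity and reflection positivity of the one-field limits of the host closure.**  For every
`(G, r)` with gap data there is a torus demand `Λ` (`rhDemand m`: `L ≥ max (1, m(β)⁻²)`) such that for every
`SoftData` witness obeying it and `PolyRenorm`, the one-field limit `S₁` is OS-hermitian and reflection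
positive (`reflHermRP_of_torusBound`). -/
theorem stub_reflHermRP :
    ∀ (G : Type) [Group G] [TopologicalSpace G] [IsTopologicalGroup G] [CompactSpace G]
      [MeasurableSpace G] [BorelSpace G], IsCompactSimpleLieGroup G →
      ∀ (r : LatticeRep G) (β₁ C₁ c₂ : ℝ) (m : ℝ → ℝ), GapData G r β₁ C₁ c₂ m →
        ∃ Λ : ℝ → ℕ → ℕ, ∀ (δ₀ : ℝ) (sch : SpeciesScheme (YMSpecies G))
          (S₁ : SchwingerFamily (EuclideanSpace ℝ (Fin 4)))
          (Spl : (n : ℕ) → (Fin n → Fin 4 × Fin 4) → (𝓢((Fin n → (EuclideanSpace ℝ (Fin 4))), ℂ) →L[ℂ] ℂ)),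
          0 < δ₀ → SoftData r m δ₀ Λ sch S₁ Spl → PolyRenorm r sch →
            S₁.toLabelled.IsHermitian ∧ S₁.toLabelled.IsReflectionPositive := by
  intro G _ _ _ _ _ _ _ r β₁ C₁ c₂ m hgap
  refine ⟨rhDemand m, fun δ₀ sch S₁ Spl _ hD hP => ?_⟩
  have hΛ : ∀ k, rhDemand m (sch.β k) k ≤ sch.L k := hD.2.2.1
  have hunits : ∀ k, sch.a k = m (sch.β k) := hD.1
  refine reflHermRP_of_torusBound r hgap hD hP (fun k => le_trans (le_max_left _ _) (hΛ k)) fun k => ?_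
  rw [hunits k]
  calc (m (sch.β k))⁻¹ * (m (sch.β k))⁻¹ ≤ (⌈(m (sch.β k))⁻¹ * (m (sch.β k))⁻¹⌉₊ : ℝ) := Nat.le_ceil _
    _ ≤ (rhDemand m (sch.β k) k : ℝ) := by
        unfold rhDemand
        exact_mod_cast le_max_right _ _
    _ ≤ sch.L k := by exact_mod_cast hΛ k

end Summit.QuantumFields.YangMills.Cruxes.HypercubicLimit.PeelAndDisseminate

end
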